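import Summits.QuantumFields.YangMills.Theorems.UnitScaleTiltProp7NestedMeanParallelLift
import Summits.QuantumFields.YangMills.Theorems.BalabanUVNodesN12FlatFibreNullSpace
import HarnessLib

/-!
# Route `UnitScaleTilt`, crux K1 child «MinimiserStabilityRegPr» (stmt-QuantumFields-19200), skeleton v10, stub `stub_existenceMinimalOrbit` (EX), route (α) —
# **THE LIFTING HYPOTHESIS `hLift` OF ✓`hHZ_of_parallelLift` INHABITED BY KERNEL IN TWO REGIMES** (the flat background `U₀♭ = 1`; averaged backgrounds with only scalar parallel
# sections — «`Ū₀` irreducible», the generic coarse field) — the generic-`V` half and one point of the (H-Z) sector of the (P2-core) plan v2 (★px10 `LOCATE-P2-CORE-v2-px10.md` §3),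
# NOT its closure: over REDUCIBLE coarse fields `hLift` fails generically (★★OWNER RULING g28-№5).

Cell `ym3-torus`, width seat `ym3-torus-px20` (gen 2).  THEOREMS ONLY (0 `def`, 0 `sorry`).  `--supports stmt-QuantumFields-19200 --as helper`, count-neutral.  YM₃ on T³ is a ladder
rung (R3), not the Clay problem; nothing here claims the stub, the crux, d = 4 or the mass gap.

WHAT IS PROVED (sorry-free, no definition; ns `…Theorems.Prop7NestedMeanParallelLift`, T³ member):
* ★`hLift_of_flat` — if `U₀♭ = 1` then every coarse section parallel for `Ū₀ = Ū₀♭⁽ᴷ⁻ⁿ⁾ = 1` (✓`emlIterU_one`) is shift-invariant, hence CONSTANT on the coarse torus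
  (✓`N12FlatFibreNullSpace.const_of_shift_eq`), and the constant fine section lifts it (parallel for `U₀♭ = 1`): `hLift` holds — the №9 (3) inhabitability of ✓p665243's displayed row, by kernel.
* ★`hLift_of_onlyScalarParallel` — if every `Ū₀`-parallel coarse section is a SCALAR constant `z • 1` («`Ū₀` has irreducible holonomy»), the scalar constant lifts it (scalars are parallel
  for every background): `hIrr → hLift`, so «`Ū₀` irreducible» is an admissible alternative display (exit (ii)′).
* `hHZ_of_flat` — at `U₀♭ = 1` the (H-Z) row of ✓`htest_of_rows` holds with NOTHING displayed (✓`hHZ_of_parallelLift` ∘ `hLift_of_flat`).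
HONEST SCOPE — NOT A CLOSURE OF THE SECTOR (★★OWNER RULING g28-№5, ★w5-20520 g7's memo `SECTOR-hLift-w5g7.md`, 19200 evidence #49): `hLift` FAILS at the generic point of the fibre
over every REDUCIBLE coarse field `V` — in particular over `V = 1` away from `U₀ = 1` (a constant `σ₃` is `Ū₀`-parallel but lifts only if it commutes with `Hol(U₀)`).  The two theorems
here cover exactly the generic-`V` half (irreducible `Ū₀`, `hLift_of_onlyScalarParallel`) and the single point `U₀♭ = 1` (`hLift_of_flat`); the reducible-`V` sector is the road of record
(c) «pointwise + compactness», not touched here.  Bookkeeping only; no stub ∕ crux statement is advanced.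

References: T. Bałaban, CMP 99 (1985) 389–434 [Balaban1985BackgroundPropagators] ((3.19)–(3.21) pp.393–394); CMP 96 (1984) 223–250 [Balaban1984PropagatorsII] ((2.7)–(2.12) pp.224–225);
CMP 98 (1985) 17–51 [Balaban1985Averaging] ((11) p.19, (97) p.32).
-/

set_option autoImplicit false

noncomputable section

open scoped BigOperators Matrix.Norms.L2Operator

namespace Summit.QuantumFields.YangMills.Theorems.Prop7NestedMeanParallelLift

open Literature.MathematicalPhysics.QuantumFieldTheory.Balaban1983to89
open T4Continuum BlockAveraging
open BlockAveraging (Idx)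
open B7Prop1Explicit (disp)
open B10Eq27TorusAxialLog (holT transl)
open B7TransferAnalyticMean (meanCLM)
open B15DeterminingSets (embIter)
open Summit.QuantumFields.YangMills.Theorems.Prop8Chart (emlIterU emlIterU_one)
open Summit.QuantumFields.YangMills.BalabanUVNodes.N12FlatFibreNullSpace (const_of_shift_eq)
open B5Positivity172Lattice (TT ofT)

section T3

open Literature.MathematicalPhysics.QuantumFieldTheory.Balaban1983to89.T3ContinuumYM3Torus
open T3PrintedRegularMinimiser (RegPr)
open T3SectALandauChart (bgUnits)
open Summit.QuantumFields.YangMills.Theorems.Prop7SectET3HilbertLetters (toL2S DL2)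
open Summit.QuantumFields.YangMills.Theorems.Prop7SectET3GaugeProjector (NS)

variable (F : T3Family) {n K : ℕ}

/-- ★ **`hLift` AT THE FLAT BACKGROUND, BY KERNEL**: if `U₀♭ = 1`, every coarse section parallel for the averaged background `Ū₀ = 1` is invariant under every unit translation,
hence constant on the (connected) coarse torus, and is the restriction of the constant fine section, which is parallel for `U₀♭ = 1`.
[cite: Balaban1984PropagatorsII, (2.7)-(2.12) pp.224-225; Balaban1985Averaging, (11) p.19] -/
theorem hLift_of_flat (U₀ : GaugeField (F.P K) 0 (Matrix.specialUnitaryGroup (Fin 2) ℂ)) (hU : bgUnits F K U₀ = fun _ => 1) :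
    ∀ cf : Site (F.P K) (K - n) → Matrix (Fin 2) (Fin 2) ℂ,
      (∀ e : PBond (F.P K) (K - n), cf e.src = ((emlIterU (K - n) (bgUnits F K U₀) e : (Matrix (Fin 2) (Fin 2) ℂ)ˣ) : Matrix (Fin 2) (Fin 2) ℂ) * cf e.tgt *
        (((emlIterU (K - n) (bgUnits F K U₀) e)⁻¹ : (Matrix (Fin 2) (Fin 2) ℂ)ˣ) : Matrix (Fin 2) (Fin 2) ℂ)) →
      ∃ l₀ : Site (F.P K) 0 → Matrix (Fin 2) (Fin 2) ℂ,
        (∀ b : PBond (F.P K) 0, l₀ b.src = ((bgUnits F K U₀ b : (Matrix (Fin 2) (Fin 2) ℂ)ˣ) : Matrix (Fin 2) (Fin 2) ℂ) * l₀ b.tgt * (((bgUnits F K U₀ b)⁻¹ : (Matrix (Fin 2) (Fin 2) ℂ)ˣ) : Matrix (Fin 2) (Fin 2) ℂ)) ∧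
        ∀ y : Site (F.P K) (K - n), l₀ (embIter (K - n) y) = cf y := by
  intro cf hpar
  have hshift : ∀ (y : Site (F.P K) (K - n)) (μ : Fin (F.P K).d), cf (y.shift μ) = cf y := by
    intro y μ
    have h := hpar ⟨y, μ⟩
    rw [hU, emlIterU_one] at h
    simp only [inv_one, Units.val_one, one_mul, mul_one] at h
    exact h.symm
  refine ⟨fun _ => cf (ofT (0 : TT (F.P K) (K - n))), fun b => ?_, fun y => (const_of_shift_eq cf hshift y).symm⟩
  rw [hU]
  simp only [inv_one, Units.val_one, one_mul, mul_one]

/-- ★ **`hLift` WHEN THE AVERAGED BACKGROUND HAS ONLY SCALAR PARALLEL SECTIONS** («`Ū₀` irreducible»): the scalar constant lifts (scalars are parallel for every `U₀`), so the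
irreducibility display `hIrr` implies `hLift`. [cite: Balaban1985BackgroundPropagators, (3.21) p.394; Balaban1984PropagatorsII, (2.12) p.225] -/
theorem hLift_of_onlyScalarParallel (U₀ : GaugeField (F.P K) 0 (Matrix.specialUnitaryGroup (Fin 2) ℂ))
    (hIrr : ∀ cf : Site (F.P K) (K - n) → Matrix (Fin 2) (Fin 2) ℂ,
      (∀ e : PBond (F.P K) (K - n), cf e.src = ((emlIterU (K - n) (bgUnits F K U₀) e : (Matrix (Fin 2) (Fin 2) ℂ)ˣ) : Matrix (Fin 2) (Fin 2) ℂ) * cf e.tgt *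
        (((emlIterU (K - n) (bgUnits F K U₀) e)⁻¹ : (Matrix (Fin 2) (Fin 2) ℂ)ˣ) : Matrix (Fin 2) (Fin 2) ℂ)) →
      ∃ z : ℂ, ∀ y, cf y = z • (1 : Matrix (Fin 2) (Fin 2) ℂ)) :
    ∀ cf : Site (F.P K) (K - n) → Matrix (Fin 2) (Fin 2) ℂ,
      (∀ e : PBond (F.P K) (K - n), cf e.src = ((emlIterU (K - n) (bgUnits F K U₀) e : (Matrix (Fin 2) (Fin 2) ℂ)ˣ) : Matrix (Fin 2) (Fin 2) ℂ) * cf e.tgt *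
        (((emlIterU (K - n) (bgUnits F K U₀) e)⁻¹ : (Matrix (Fin 2) (Fin 2) ℂ)ˣ) : Matrix (Fin 2) (Fin 2) ℂ)) →
      ∃ l₀ : Site (F.P K) 0 → Matrix (Fin 2) (Fin 2) ℂ,
        (∀ b : PBond (F.P K) 0, l₀ b.src = ((bgUnits F K U₀ b : (Matrix (Fin 2) (Fin 2) ℂ)ˣ) : Matrix (Fin 2) (Fin 2) ℂ) * l₀ b.tgt * (((bgUnits F K U₀ b)⁻¹ : (Matrix (Fin 2) (Fin 2) ℂ)ˣ) : Matrix (Fin 2) (Fin 2) ℂ)) ∧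
        ∀ y : Site (F.P K) (K - n), l₀ (embIter (K - n) y) = cf y := by
  intro cf hpar
  obtain ⟨z, hz⟩ := hIrr cf hpar
  refine ⟨fun _ => z • (1 : Matrix (Fin 2) (Fin 2) ℂ), fun b => ?_, fun y => (hz y).symm⟩
  rw [mul_smul_comm, smul_mul_assoc, mul_one, Units.mul_inv]

/-- **(H-Z) AT THE FLAT BACKGROUND WITH NOTHING DISPLAYED**: ✓`hHZ_of_parallelLift` ∘ `hLift_of_flat`. [cite: Balaban1985BackgroundPropagators, (3.19)-(3.21) pp.393-394] -/
theorem hHZ_of_flat (h : n ≤ K) {c₀ : ℝ} [Fact (0 < c₀)] {cB : ℝ} {ε₀ : ℝ} (hε₀ : 0 < ε₀) (hWε : 10 ^ 12 * (F.L : ℝ) ^ 3 * ε₀ ≤ 1)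
    (U₀ : GaugeField (F.P K) 0 (Matrix.specialUnitaryGroup (Fin 2) ℂ)) (hreg : RegPr F n K ε₀ U₀) (hU : bgUnits F K U₀ = fun _ => 1) :
    ∀ l : Site (F.P K) 0 → Matrix (Fin 2) (Fin 2) ℂ, toL2S F K c₀ l ∈ NS F n K h c₀ cB U₀ →
      ∃ l₁ : Site (F.P K) 0 → Matrix (Fin 2) (Fin 2) ℂ, toL2S F K c₀ l₁ ∈ NS F n K h c₀ cB U₀ ∧
        (∃ ns : (j : ℕ) → Site (F.P K) j → Matrix (Fin 2) (Fin 2) ℂ, ns 0 = l₁ ∧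
          (∀ (j : ℕ) (y : Site (F.P K) (j + 1)), ns (j + 1) y = ns j (emb y) - meanCLM (Idx (F.P K)) (Matrix (Fin 2) (Fin 2) ℂ) fun i : Idx (F.P K) =>
            ns j (emb y) - ((holT (emlIterU j (bgUnits F K U₀)) (emb y) (stairWord i.2.1 (off i.1)) : (Matrix (Fin 2) (Fin 2) ℂ)ˣ) : Matrix (Fin 2) (Fin 2) ℂ) *
              ns j (transl (emb y) (disp (stairWord i.2.1 (off i.1)))) * (((holT (emlIterU j (bgUnits F K U₀)) (emb y) (stairWord i.2.1 (off i.1)))⁻¹ : (Matrix (Fin 2) (Fin 2) ℂ)ˣ) : Matrix (Fin 2) (Fin 2) ℂ)) ∧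
          ∀ y, ns (K - n) y = 0) ∧
        DL2 F n K c₀ U₀ (toL2S F K c₀ l₁) = DL2 F n K c₀ U₀ (toL2S F K c₀ l) :=
  hHZ_of_parallelLift F h hε₀ hWε U₀ hreg (hLift_of_flat F U₀ hU)

end T3

end Summit.QuantumFields.YangMills.Theorems.Prop7NestedMeanParallelLift

end
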